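import Summits.QuantumFields.YangMills.Theorems.ColdStartUniversalityLatticeLangevinMartingaleCLTWeights
import HarnessLib

/-!
# Route `ColdStartUniversality` (fixed-cut-off SZZ dynamics, sampler package): the MARTINGALE CENTRAL LIMIT MECHANISM, part 2 —
# bounded increments ORTHOGONAL TO THE PAST with a PREDICTABLE VARIANCE PROXY: `|E[exp(iθ S_n + θ²V_n/2)] − 1| ≤ n e^(nθ²δ/2) ρ(θ)`

Helper file (seat `ym-line-csu-p1`, g35; `--supports stmt-QuantumFields-24809`).  Generic probability, no SZZ object: the engine of the
CENTRAL LIMIT THEOREMS for the ergodic averages of the cold-start Langevin sampler (next files).  On ANY probability space let `D₀, D₁, …`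
be real random variables with `|D_k| ≤ B`, `v₀, v₁, …` random variables with `0 ≤ v_k ≤ δ` ("predictable variance proxies"), and
`ℱ₀, ℱ₁, …` sub-σ-algebras such that `S_k = Σ_(j<k) D_j` and `V_k = Σ_(j<k) v_j` are `ℱ_k`-measurable.  Suppose that for every `k < n` and
every bounded non-negative `ℱ_k`-measurable weight `Z`
  (orthogonality)      `E[Z · D_k] = 0`,
  (variance proxy)     `|E[Z · (D_k² − v_k)]| ≤ η · E[Z]`.
Then for every real `θ` (★★ `norm_integral_cexp_sum_sub_one_le`)

  `|E[exp(iθ S_n + (θ²/2) V_n)] − 1| ≤ n · e^(nθ²δ/2) · ρ(θ; B, δ, η)`,   `ρ = θ²η + |θ|³ e^(|θ|B) B (δ + η) + (θ²δ/2)² + (|θ|B + θ²B²/2)(θ²δ/2)`,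

by telescoping `W_(k+1) − W_k = W_k (e^(iθD_k + θ²v_k/2) − 1)` with the COMPLEX `ℱ_k`-measurable weight `W_k = exp(iθS_k + θ²V_k/2)`
(★ `norm_integral_cweight_mul_cexp_sub_one_le`, one step: third-order Taylor expansion; the linear term vanishes by orthogonality, the quadratic
term is `−(θ²/2)E[W_k(D_k² − v_k)]`, the cubic term is controlled by `|D|³ ≤ B D²`; no conditional expectations).  In the applications `D_k, v_k`
carry the factors `N^(−1/2), N^(−1)`, so `B², δ, η` are `O(1/N), O(1/N), o(1/N)` and `nρ → 0`.  THEOREMS ONLY, no definition, no sorry; [folklore]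
(the Lindeberg–Lévy method for martingale differences: Brown 1971, McLeish 1974; Hall–Heyde, Martingale Limit Theory §3.2).  HONEST FRAMING: plumbing for fixed-cut-off sampler statements; `UniformColdStartMixing` (24809) is NOT restated; no crux, rung or summit
statement is proved; the Yang–Mills mass gap is NOT proved.
-/

set_option autoImplicit false

noncomputable section

namespace Summit.QuantumFields.YangMills.Theorems.ColdStartUniversality

open MeasureTheory ProbabilityTheory Filter Topology Finset
open scoped NNReal ENNReal BigOperators

/-! ## §3. One step of the telescoping: a complex `ℱ`-measurable weight against `e^(iθD + θ²v/2) − 1` -/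

/-- ★ **One CLT step.**  `ℱ`-measurable complex weight `W` (`‖W‖ ≤ M`), increment `D` (`|D| ≤ B`) orthogonal to every bounded
non-negative `ℱ`-measurable weight, variance proxy `0 ≤ v ≤ δ` with `|E[Z(D² − v)]| ≤ η E[Z]` for the same weights.  Then
`‖E[W·(e^(iθD + θ²v/2) − 1)]‖ ≤ M e^(θ²δ/2) ρ(θ)`, `ρ = θ²η + |θ|³e^(|θ|B) B(δ+η) + (θ²δ/2)² + (|θ|B + θ²B²/2)(θ²δ/2)`
(third-order Taylor expansion; the linear term vanishes, the quadratic term is `−(θ²/2) E[W(D² − v)]`). [folklore] -/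
theorem norm_integral_cweight_mul_cexp_sub_one_le {Ω : Type*} {ℱ mΩ : MeasurableSpace Ω} {P : Measure Ω} [IsProbabilityMeasure P]
    (hℱ : ℱ ≤ mΩ) {W : Ω → ℂ} (hW : Measurable[ℱ] W) {M : ℝ} (hM : 0 ≤ M) (hWb : ∀ ω, ‖W ω‖ ≤ M)
    {D v : Ω → ℝ} (hDm : Measurable D) (hvm : Measurable v) {B δ η : ℝ} (hB : 0 ≤ B) (hδ : 0 ≤ δ) (hη : 0 ≤ η)
    (hDb : ∀ ω, |D ω| ≤ B) (hv0 : ∀ ω, 0 ≤ v ω) (hvb : ∀ ω, v ω ≤ δ)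
    (horth : ∀ Z : Ω → ℝ, Measurable[ℱ] Z → (∀ ω, 0 ≤ Z ω) → (∃ C : ℝ, ∀ ω, Z ω ≤ C) → ∫ ω, Z ω * D ω ∂P = 0)
    (hvar : ∀ Z : Ω → ℝ, Measurable[ℱ] Z → (∀ ω, 0 ≤ Z ω) → (∃ C : ℝ, ∀ ω, Z ω ≤ C) →
      |∫ ω, Z ω * (D ω ^ 2 - v ω) ∂P| ≤ η * ∫ ω, Z ω ∂P)
    (θ : ℝ) :
    ‖∫ ω, W ω * (Complex.exp (((θ * D ω : ℝ) : ℂ) * Complex.I + ((θ ^ 2 / 2 * v ω : ℝ) : ℂ)) - 1) ∂P‖ ≤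
      M * Real.exp (θ ^ 2 * δ / 2) * (θ ^ 2 * η + |θ| ^ 3 * Real.exp (|θ| * B) * B * (δ + η) +
        (θ ^ 2 * δ / 2) ^ 2 + (|θ| * B + θ ^ 2 * B ^ 2 / 2) * (θ ^ 2 * δ / 2)) := by
  have hWm : Measurable W := hW.mono hℱ le_rfl
  -- two elementary inequalities: `e^a − 1 ≤ a e^a` (from `1 − a ≤ e^(−a)`) and `e^a − 1 − a ≤ a² e^a` for `a ≥ 0`
  have hexp1 : ∀ a : ℝ, Real.exp a - 1 ≤ a * Real.exp a := fun a => by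
    have h1 := Real.add_one_le_exp (-a)
    have h2 : Real.exp (-a) * Real.exp a = 1 := by rw [← Real.exp_add, neg_add_cancel, Real.exp_zero]
    nlinarith [Real.exp_pos a, Real.exp_pos (-a)]
  have hexp2 : ∀ a : ℝ, 0 ≤ a → Real.exp a - 1 - a ≤ a ^ 2 * Real.exp a := fun a ha => by
    have h1 := hexp1 a
    have h2 : 0 ≤ a * (a * Real.exp a - (Real.exp a - 1)) := mul_nonneg ha (by linarith)
    nlinarith [Real.exp_pos a, Real.add_one_le_exp a, ha]
  set A : ℝ := θ ^ 2 * δ / 2 with hA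
  have hA0 : 0 ≤ A := by positivity
  set X : Ω → ℂ := fun ω => ((θ * D ω : ℝ) : ℂ) * Complex.I with hX
  set a : Ω → ℝ := fun ω => θ ^ 2 / 2 * v ω with ha
  have ha0 : ∀ ω, 0 ≤ a ω := fun ω => mul_nonneg (by positivity) (hv0 ω)
  have haA : ∀ ω, a ω ≤ A := fun ω => by
    simp only [ha, hA]
    have := hvb ω
    nlinarith [sq_nonneg θ]
  have hXm : Measurable X := (Complex.measurable_ofReal.comp (hDm.const_mul θ)).mul_const _
  have ham : Measurable a := hvm.const_mul _
  have hXn : ∀ ω, ‖X ω‖ = |θ| * |D ω| := fun ω => by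
    simp only [hX, norm_mul, Complex.norm_I, mul_one, Complex.norm_real, Real.norm_eq_abs]
  have hXb : ∀ ω, ‖X ω‖ ≤ |θ| * B := fun ω => by rw [hXn]; exact mul_le_mul_of_nonneg_left (hDb ω) (abs_nonneg θ)
  have hX2 : ∀ ω, X ω ^ 2 = -((((θ * D ω : ℝ) : ℂ)) ^ 2) := fun ω => by
    simp only [hX]; rw [mul_pow, Complex.I_sq]; ring
  -- the remainders
  set R2 : Ω → ℝ := fun ω => Real.exp (a ω) - 1 - a ω with hR2
  set E1 : Ω → ℝ := fun ω => Real.exp (a ω) - 1 with hE1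
  set R3 : Ω → ℂ := fun ω => Complex.exp (X ω) - 1 - X ω - X ω ^ 2 / 2 with hR3
  set Rest : Ω → ℂ := fun ω => (R2 ω : ℂ) + (X ω + X ω ^ 2 / 2) * (E1 ω : ℂ) + R3 ω * ((Real.exp (a ω) : ℝ) : ℂ) with hRest
  have hR2b : ∀ ω, |R2 ω| ≤ A ^ 2 * Real.exp A := fun ω => by
    have h0 : 0 ≤ R2 ω := by
      simp only [hR2]; linarith [Real.add_one_le_exp (a ω)]
    rw [abs_of_nonneg h0]
    simp only [hR2]
    calc Real.exp (a ω) - 1 - a ω ≤ a ω ^ 2 * Real.exp (a ω) := hexp2 _ (ha0 ω)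
      _ ≤ A ^ 2 * Real.exp A := mul_le_mul (pow_le_pow_left₀ (ha0 ω) (haA ω) 2) (Real.exp_le_exp.2 (haA ω))
          (Real.exp_pos _).le (by positivity)
  have hE1b : ∀ ω, |E1 ω| ≤ A * Real.exp A := fun ω => by
    have h0 : 0 ≤ E1 ω := by simp only [hE1]; linarith [Real.add_one_le_exp (a ω), ha0 ω]
    rw [abs_of_nonneg h0]
    simp only [hE1]
    calc Real.exp (a ω) - 1 ≤ a ω * Real.exp (a ω) := hexp1 (a ω)
      _ ≤ A * Real.exp A := mul_le_mul (haA ω) (Real.exp_le_exp.2 (haA ω)) (Real.exp_pos _).le hA0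
  have hR3b : ∀ ω, ‖R3 ω‖ ≤ |θ| ^ 3 * Real.exp (|θ| * B) * |D ω| ^ 3 := fun ω => by
    simp only [hR3, hX]
    have h := norm_cexp_mul_I_sub_taylor_le (θ * D ω)
    calc ‖Complex.exp (((θ * D ω : ℝ) : ℂ) * Complex.I) - 1 - ((θ * D ω : ℝ) : ℂ) * Complex.I -
          (((θ * D ω : ℝ) : ℂ) * Complex.I) ^ 2 / 2‖ ≤ |θ * D ω| ^ 3 * Real.exp |θ * D ω| := h
      _ ≤ |θ * D ω| ^ 3 * Real.exp (|θ| * B) := by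
          refine mul_le_mul_of_nonneg_left (Real.exp_le_exp.2 ?_) (by positivity)
          rw [abs_mul]; exact mul_le_mul_of_nonneg_left (hDb ω) (abs_nonneg θ)
      _ = |θ| ^ 3 * Real.exp (|θ| * B) * |D ω| ^ 3 := by rw [abs_mul, mul_pow]; ring
  have hexpa : ∀ ω, |Real.exp (a ω)| ≤ Real.exp A := fun ω => by
    rw [abs_of_pos (Real.exp_pos _)]; exact Real.exp_le_exp.2 (haA ω)
  -- the pointwise decomposition
  have hdec : ∀ ω, W ω * (Complex.exp (((θ * D ω : ℝ) : ℂ) * Complex.I + ((θ ^ 2 / 2 * v ω : ℝ) : ℂ)) - 1) =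
      W ω * (D ω : ℂ) * ((θ : ℂ) * Complex.I) + W ω * (X ω ^ 2 / 2 + (a ω : ℂ)) + W ω * Rest ω := fun ω => by
    have he : Complex.exp (((θ * D ω : ℝ) : ℂ) * Complex.I + ((θ ^ 2 / 2 * v ω : ℝ) : ℂ)) =
        Complex.exp (X ω) * ((Real.exp (a ω) : ℝ) : ℂ) := by
      rw [Complex.exp_add, Complex.ofReal_exp]
    rw [he]
    simp only [hRest, hR2, hE1, hR3, hX]
    push_cast
    ring
  have hquad : ∀ ω, W ω * (X ω ^ 2 / 2 + (a ω : ℂ)) = W ω * ((D ω ^ 2 - v ω : ℝ) : ℂ) * (-((θ : ℂ) ^ 2) / 2) := fun ω => by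
    rw [hX2 ω]
    simp only [ha]
    push_cast
    ring
  -- integrability of the three pieces (bounded measurable functions on a probability space)
  have hIntC : ∀ {g : Ω → ℂ} {Cg : ℝ}, Measurable g → (∀ ω, ‖g ω‖ ≤ Cg) → Integrable g P :=
    fun {g Cg} hg hgb => (integrable_const Cg).mono' hg.aestronglyMeasurable (Eventually.of_forall hgb)
  have hDC : Measurable fun ω => (D ω : ℂ) := Complex.measurable_ofReal.comp hDm
  have i1 : Integrable (fun ω => W ω * (D ω : ℂ) * ((θ : ℂ) * Complex.I)) P :=
    hIntC (Cg := M * B * |θ|) ((hWm.mul hDC).mul_const _) fun ω => by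
      rw [norm_mul, norm_mul, norm_mul, Complex.norm_I, mul_one, Complex.norm_real, Complex.norm_real, Real.norm_eq_abs,
        Real.norm_eq_abs]
      exact mul_le_mul (mul_le_mul (hWb ω) (hDb ω) (abs_nonneg _) hM) le_rfl (abs_nonneg _) (by positivity)
  have hf2m : Measurable fun ω => D ω ^ 2 - v ω := (hDm.pow_const 2).sub hvm
  have hD2b : ∀ ω, D ω ^ 2 ≤ B ^ 2 := fun ω => by rw [← sq_abs]; exact pow_le_pow_left₀ (abs_nonneg _) (hDb ω) 2
  have hf2b : ∀ ω, |D ω ^ 2 - v ω| ≤ B ^ 2 + δ := fun ω => (abs_sub _ _).trans (by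
    rw [abs_of_nonneg (sq_nonneg _), abs_of_nonneg (hv0 ω)]
    linarith [hvb ω, hD2b ω])
  have hq_m : Measurable fun ω => W ω * ((D ω ^ 2 - v ω : ℝ) : ℂ) * (-((θ : ℂ) ^ 2) / 2) :=
    ((hWm.mul (Complex.measurable_ofReal.comp ((hDm.pow_const 2).sub hvm))).mul_const _)
  have i2 : Integrable (fun ω => W ω * (X ω ^ 2 / 2 + (a ω : ℂ))) P := by
    have h := hIntC (Cg := M * (B ^ 2 + δ) * (θ ^ 2 / 2)) hq_m (fun ω => by
      have hn : ‖(-((θ : ℂ) ^ 2) / 2)‖ = θ ^ 2 / 2 := by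
        rw [norm_div, norm_neg, norm_pow, Complex.norm_real, Real.norm_eq_abs, sq_abs]; norm_num
      rw [norm_mul, norm_mul, hn, Complex.norm_real, Real.norm_eq_abs]
      exact mul_le_mul (mul_le_mul (hWb ω) (hf2b ω) (abs_nonneg _) hM) le_rfl (by positivity) (by positivity))
    exact h.congr (ae_of_all _ fun ω => (hquad ω).symm)
  have hRestm : Measurable Rest := by
    simp only [hRest, hR2, hE1, hR3]
    exact ((Complex.measurable_ofReal.comp ((ham.exp.sub measurable_const).sub ham)).add
      ((hXm.add ((hXm.pow_const 2).div_const 2)).mul (Complex.measurable_ofReal.comp (ham.exp.sub measurable_const)))).add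
      ((((hXm.cexp.sub measurable_const).sub hXm).sub ((hXm.pow_const 2).div_const 2)).mul
        (Complex.measurable_ofReal.comp ham.exp))
  set CR : ℝ := A ^ 2 * Real.exp A + (|θ| * B + θ ^ 2 * B ^ 2 / 2) * (A * Real.exp A) +
    |θ| ^ 3 * Real.exp (|θ| * B) * B ^ 3 * Real.exp A with hCR
  have hRestb' : ∀ ω, ‖Rest ω‖ ≤ A ^ 2 * Real.exp A + (|θ| * B + θ ^ 2 * B ^ 2 / 2) * (A * Real.exp A) +
      |θ| ^ 3 * Real.exp (|θ| * B) * |D ω| ^ 3 * Real.exp A := fun ω => by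
    simp only [hRest]
    have hXX : ‖X ω + X ω ^ 2 / 2‖ ≤ |θ| * B + θ ^ 2 * B ^ 2 / 2 := by
      calc ‖X ω + X ω ^ 2 / 2‖ ≤ ‖X ω‖ + ‖X ω ^ 2 / 2‖ := norm_add_le _ _
        _ = ‖X ω‖ + ‖X ω‖ ^ 2 / 2 := by rw [norm_div, norm_pow]; norm_num
        _ ≤ |θ| * B + (|θ| * B) ^ 2 / 2 := by
            have h1 := hXb ω
            have h2 : ‖X ω‖ ^ 2 ≤ (|θ| * B) ^ 2 := pow_le_pow_left₀ (norm_nonneg _) h1 2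
            linarith
        _ = |θ| * B + θ ^ 2 * B ^ 2 / 2 := by rw [mul_pow, sq_abs]
    calc ‖(R2 ω : ℂ) + (X ω + X ω ^ 2 / 2) * (E1 ω : ℂ) + R3 ω * ((Real.exp (a ω) : ℝ) : ℂ)‖
        ≤ ‖(R2 ω : ℂ)‖ + ‖(X ω + X ω ^ 2 / 2) * (E1 ω : ℂ)‖ + ‖R3 ω * ((Real.exp (a ω) : ℝ) : ℂ)‖ := norm_add₃_le
      _ = |R2 ω| + ‖X ω + X ω ^ 2 / 2‖ * |E1 ω| + ‖R3 ω‖ * |Real.exp (a ω)| := by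
          rw [norm_mul, norm_mul, Complex.norm_real, Complex.norm_real, Complex.norm_real, Real.norm_eq_abs, Real.norm_eq_abs,
            Real.norm_eq_abs]
      _ ≤ A ^ 2 * Real.exp A + (|θ| * B + θ ^ 2 * B ^ 2 / 2) * (A * Real.exp A) +
          |θ| ^ 3 * Real.exp (|θ| * B) * |D ω| ^ 3 * Real.exp A :=
          add_le_add (add_le_add (hR2b ω) (mul_le_mul hXX (hE1b ω) (abs_nonneg _) (by positivity)))
            (mul_le_mul (hR3b ω) (hexpa ω) (abs_nonneg _) (by positivity))
  have hRestb : ∀ ω, ‖Rest ω‖ ≤ CR := fun ω => (hRestb' ω).trans (by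
    simp only [hCR]
    have h3 : |D ω| ^ 3 ≤ B ^ 3 := pow_le_pow_left₀ (abs_nonneg _) (hDb ω) 3
    gcongr)
  have i3 : Integrable (fun ω => W ω * Rest ω) P := hIntC (hWm.mul hRestm) fun ω => by
    rw [norm_mul]; exact mul_le_mul (hWb ω) (hRestb ω) (norm_nonneg _) hM
  -- split the integral
  have i12 : Integrable (fun ω => W ω * (D ω : ℂ) * ((θ : ℂ) * Complex.I) + W ω * (X ω ^ 2 / 2 + (a ω : ℂ))) P := i1.add i2
  rw [integral_congr_ae (ae_of_all _ hdec), integral_add i12 i3, integral_add i1 i2]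
  -- (1) the linear term vanishes
  have hlin : ∫ ω, W ω * (D ω : ℂ) * ((θ : ℂ) * Complex.I) ∂P = 0 := by
    rw [integral_mul_const]
    have h0 : ‖∫ ω, W ω * (D ω : ℂ) ∂P‖ ≤ 2 * 0 * M :=
      norm_integral_cmul_le_of_nonneg_weights hℱ hDm hDb le_rfl (fun Z hZ hZ0 hZb => by
        rw [horth Z hZ hZ0 hZb, abs_zero, zero_mul]) hW hWb
    rw [mul_zero, zero_mul] at h0
    rw [norm_le_zero_iff.1 h0, zero_mul]
  -- (2) the quadratic term
  have hquadI : ‖∫ ω, W ω * (X ω ^ 2 / 2 + (a ω : ℂ)) ∂P‖ ≤ θ ^ 2 * η * M := by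
    rw [integral_congr_ae (ae_of_all _ hquad), integral_mul_const, norm_mul]
    have h := norm_integral_cmul_le_of_nonneg_weights hℱ hf2m hf2b hη hvar hW hWb
    have hn : ‖(-((θ : ℂ) ^ 2) / 2)‖ = θ ^ 2 / 2 := by
      rw [norm_div, norm_neg, norm_pow, Complex.norm_real, Real.norm_eq_abs, sq_abs]; norm_num
    rw [hn]
    calc ‖∫ ω, W ω * ((D ω ^ 2 - v ω : ℝ) : ℂ) ∂P‖ * (θ ^ 2 / 2) ≤ 2 * η * M * (θ ^ 2 / 2) :=
          mul_le_mul_of_nonneg_right h (by positivity)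
      _ = θ ^ 2 * η * M := by ring
  -- (3) the remainder
  have hWn : Measurable[ℱ] fun ω => ‖W ω‖ := measurable_norm.comp hW
  have hcub : ∫ ω, ‖W ω‖ * |D ω| ^ 3 ∂P ≤ B * ((δ + η) * M) := by
    have hv' := hvar (fun ω => ‖W ω‖) hWn (fun ω => norm_nonneg _) ⟨M, hWb⟩
    have hIntR : ∀ {g : Ω → ℝ} {Cg : ℝ}, Measurable g → (∀ ω, |g ω| ≤ Cg) → Integrable g P :=
      fun {g Cg} hg hgb => (integrable_const Cg).mono' hg.aestronglyMeasurable
        (Eventually.of_forall fun ω => by rw [Real.norm_eq_abs]; exact hgb ω)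
    have hWnm : Measurable fun ω => ‖W ω‖ := hWm.norm
    have iWv : Integrable (fun ω => ‖W ω‖ * v ω) P := hIntR (hWnm.mul hvm) fun ω => by
      rw [abs_mul, abs_norm, abs_of_nonneg (hv0 ω)]; exact mul_le_mul (hWb ω) (hvb ω) (hv0 ω) hM
    have iWD2 : Integrable (fun ω => ‖W ω‖ * D ω ^ 2) P := hIntR (hWnm.mul (hDm.pow_const 2)) fun ω => by
      rw [abs_mul, abs_norm, abs_of_nonneg (sq_nonneg _)]; exact mul_le_mul (hWb ω) (hD2b ω) (sq_nonneg _) hM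
    have iWD3 : Integrable (fun ω => ‖W ω‖ * |D ω| ^ 3) P := hIntR (hWnm.mul ((hDm.abs).pow_const 3)) fun ω => by
      rw [abs_mul, abs_norm, abs_of_nonneg (by positivity)]
      exact mul_le_mul (hWb ω) (pow_le_pow_left₀ (abs_nonneg _) (hDb ω) 3) (by positivity) hM
    have iW : Integrable (fun ω => ‖W ω‖) P := hIntR hWnm fun ω => by rw [abs_norm]; exact hWb ω
    have hsplit : ∫ ω, ‖W ω‖ * (D ω ^ 2 - v ω) ∂P = (∫ ω, ‖W ω‖ * D ω ^ 2 ∂P) - ∫ ω, ‖W ω‖ * v ω ∂P := by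
      rw [← integral_sub iWD2 iWv]; exact integral_congr_ae (ae_of_all _ fun ω => by ring)
    have hWvI : ∫ ω, ‖W ω‖ * v ω ∂P ≤ δ * M := by
      calc ∫ ω, ‖W ω‖ * v ω ∂P ≤ ∫ ω, M * δ ∂P :=
            integral_mono iWv (integrable_const _) fun ω => mul_le_mul (hWb ω) (hvb ω) (hv0 ω) hM
        _ = δ * M := by simp [mul_comm]
    have hWI : ∫ ω, ‖W ω‖ ∂P ≤ M := by
      calc ∫ ω, ‖W ω‖ ∂P ≤ ∫ ω, M ∂P := integral_mono iW (integrable_const _) hWb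
        _ = M := by simp
    have hD2I : ∫ ω, ‖W ω‖ * D ω ^ 2 ∂P ≤ (δ + η) * M := by
      have h1 := (abs_le.1 hv').2
      rw [hsplit] at h1
      nlinarith [mul_le_mul_of_nonneg_left hWI hη]
    calc ∫ ω, ‖W ω‖ * |D ω| ^ 3 ∂P ≤ ∫ ω, B * (‖W ω‖ * D ω ^ 2) ∂P := by
          refine integral_mono iWD3 (iWD2.const_mul B) fun ω => ?_
          have h3 : |D ω| ^ 3 = |D ω| * D ω ^ 2 := by rw [pow_succ', sq_abs]
          rw [h3]
          calc ‖W ω‖ * (|D ω| * D ω ^ 2) = |D ω| * (‖W ω‖ * D ω ^ 2) := by ring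
            _ ≤ B * (‖W ω‖ * D ω ^ 2) := mul_le_mul_of_nonneg_right (hDb ω) (by positivity)
      _ = B * ∫ ω, ‖W ω‖ * D ω ^ 2 ∂P := integral_const_mul _ _
      _ ≤ B * ((δ + η) * M) := mul_le_mul_of_nonneg_left hD2I hB
  have hrestI : ‖∫ ω, W ω * Rest ω ∂P‖ ≤ M * (A ^ 2 * Real.exp A + (|θ| * B + θ ^ 2 * B ^ 2 / 2) * (A * Real.exp A)) +
      |θ| ^ 3 * Real.exp (|θ| * B) * Real.exp A * (B * ((δ + η) * M)) := by
    have hWnm : Measurable fun ω => ‖W ω‖ := hWm.norm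
    have iR1 : Integrable (fun ω => ‖W ω‖ * (A ^ 2 * Real.exp A + (|θ| * B + θ ^ 2 * B ^ 2 / 2) * (A * Real.exp A))) P :=
      ((integrable_const M).mono' hWnm.aestronglyMeasurable (Eventually.of_forall fun ω => by
        rw [norm_norm]; exact hWb ω)).mul_const _
    have iR2 : Integrable (fun ω => |θ| ^ 3 * Real.exp (|θ| * B) * Real.exp A * (‖W ω‖ * |D ω| ^ 3)) P := by
      refine Integrable.const_mul ?_ _
      exact (integrable_const (M * B ^ 3)).mono' (hWnm.mul ((hDm.abs).pow_const 3)).aestronglyMeasurable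
        (Eventually.of_forall fun ω => by
          rw [Real.norm_eq_abs, abs_mul, abs_norm, abs_of_nonneg (by positivity)]
          exact mul_le_mul (hWb ω) (pow_le_pow_left₀ (abs_nonneg _) (hDb ω) 3) (by positivity) hM)
    calc ‖∫ ω, W ω * Rest ω ∂P‖ ≤ ∫ ω, ‖W ω * Rest ω‖ ∂P := norm_integral_le_integral_norm _
      _ ≤ ∫ ω, (‖W ω‖ * (A ^ 2 * Real.exp A + (|θ| * B + θ ^ 2 * B ^ 2 / 2) * (A * Real.exp A)) +
            |θ| ^ 3 * Real.exp (|θ| * B) * Real.exp A * (‖W ω‖ * |D ω| ^ 3)) ∂P := by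
          refine integral_mono i3.norm (iR1.add iR2) fun ω => ?_
          rw [norm_mul]
          have h := mul_le_mul_of_nonneg_left (hRestb' ω) (norm_nonneg (W ω))
          refine h.trans (le_of_eq ?_)
          ring
      _ = (∫ ω, ‖W ω‖ ∂P) * (A ^ 2 * Real.exp A + (|θ| * B + θ ^ 2 * B ^ 2 / 2) * (A * Real.exp A)) +
            |θ| ^ 3 * Real.exp (|θ| * B) * Real.exp A * ∫ ω, ‖W ω‖ * |D ω| ^ 3 ∂P := by
          rw [integral_add iR1 iR2, integral_mul_const, integral_const_mul]
      _ ≤ M * (A ^ 2 * Real.exp A + (|θ| * B + θ ^ 2 * B ^ 2 / 2) * (A * Real.exp A)) +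
            |θ| ^ 3 * Real.exp (|θ| * B) * Real.exp A * (B * ((δ + η) * M)) := by
          have hWI : ∫ ω, ‖W ω‖ ∂P ≤ M := by
            calc ∫ ω, ‖W ω‖ ∂P ≤ ∫ ω, M ∂P := integral_mono ((integrable_const M).mono' hWnm.aestronglyMeasurable
                  (Eventually.of_forall fun ω => by rw [norm_norm]; exact hWb ω)) (integrable_const _) hWb
              _ = M := by simp
          gcongr
  -- assemble
  have hA1 : 1 ≤ Real.exp A := Real.one_le_exp hA0
  calc ‖(∫ ω, W ω * (D ω : ℂ) * ((θ : ℂ) * Complex.I) ∂P) + (∫ ω, W ω * (X ω ^ 2 / 2 + (a ω : ℂ)) ∂P) +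
        ∫ ω, W ω * Rest ω ∂P‖
      ≤ ‖∫ ω, W ω * (D ω : ℂ) * ((θ : ℂ) * Complex.I) ∂P‖ + ‖∫ ω, W ω * (X ω ^ 2 / 2 + (a ω : ℂ)) ∂P‖ +
          ‖∫ ω, W ω * Rest ω ∂P‖ := norm_add₃_le
    _ ≤ 0 + θ ^ 2 * η * M + (M * (A ^ 2 * Real.exp A + (|θ| * B + θ ^ 2 * B ^ 2 / 2) * (A * Real.exp A)) +
          |θ| ^ 3 * Real.exp (|θ| * B) * Real.exp A * (B * ((δ + η) * M))) := by
        rw [hlin, norm_zero]; exact add_le_add (add_le_add le_rfl hquadI) hrestI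
    _ ≤ M * Real.exp A * (θ ^ 2 * η + |θ| ^ 3 * Real.exp (|θ| * B) * B * (δ + η) + A ^ 2 +
          (|θ| * B + θ ^ 2 * B ^ 2 / 2) * A) := by
        have h1 : θ ^ 2 * η * M ≤ θ ^ 2 * η * M * Real.exp A := le_mul_of_one_le_right (by positivity) hA1
        nlinarith [h1]

/-! ## §4. Telescoping: `|E[exp(iθ S_n + (θ²/2) V_n)] − 1| ≤ n e^(nθ²δ/2) ρ(θ)` -/

/-- ★★ **The martingale CLT estimate (telescoping form).**  Bounded increments `D_k` (`|D_k| ≤ B`) orthogonal to the past `ℱ_k`,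
predictable variance proxies `0 ≤ v_k ≤ δ` with `|E[Z(D_k² − v_k)]| ≤ η E[Z]` for bounded non-negative `ℱ_k`-measurable `Z`, and
`S_k = Σ_(j<k) D_j`, `V_k = Σ_(j<k) v_j` `ℱ_k`-measurable.  Then for every real `θ`:
`‖E[exp(iθ S_n + (θ²/2) V_n)] − 1‖ ≤ n · e^(nθ²δ/2) · ρ(θ)`, `ρ = θ²η + |θ|³e^(|θ|B)B(δ+η) + (θ²δ/2)² + (|θ|B + θ²B²/2)(θ²δ/2)`.
[folklore] -/
theorem norm_integral_cexp_sum_sub_one_le {Ω : Type*} {mΩ : MeasurableSpace Ω} {P : Measure Ω} [IsProbabilityMeasure P]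
    (ℱ : ℕ → MeasurableSpace Ω) (hℱ : ∀ k, ℱ k ≤ mΩ)
    (D v : ℕ → Ω → ℝ) (hDm : ∀ k, Measurable (D k)) (hvm : ∀ k, Measurable (v k))
    {B δ η : ℝ} (hB : 0 ≤ B) (hδ : 0 ≤ δ) (hη : 0 ≤ η)
    (hDb : ∀ k ω, |D k ω| ≤ B) (hv0 : ∀ k ω, 0 ≤ v k ω) (hvb : ∀ k ω, v k ω ≤ δ)
    (hSF : ∀ k, Measurable[ℱ k] fun ω => ∑ j ∈ Finset.range k, D j ω)
    (hVF : ∀ k, Measurable[ℱ k] fun ω => ∑ j ∈ Finset.range k, v j ω)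
    (n : ℕ)
    (horth : ∀ k < n, ∀ Z : Ω → ℝ, Measurable[ℱ k] Z → (∀ ω, 0 ≤ Z ω) → (∃ C : ℝ, ∀ ω, Z ω ≤ C) →
      ∫ ω, Z ω * D k ω ∂P = 0)
    (hvar : ∀ k < n, ∀ Z : Ω → ℝ, Measurable[ℱ k] Z → (∀ ω, 0 ≤ Z ω) → (∃ C : ℝ, ∀ ω, Z ω ≤ C) →
      |∫ ω, Z ω * (D k ω ^ 2 - v k ω) ∂P| ≤ η * ∫ ω, Z ω ∂P)
    (θ : ℝ) :
    ‖(∫ ω, Complex.exp (((θ * ∑ j ∈ Finset.range n, D j ω : ℝ) : ℂ) * Complex.I +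
        ((θ ^ 2 / 2 * ∑ j ∈ Finset.range n, v j ω : ℝ) : ℂ)) ∂P) - 1‖ ≤
      n * Real.exp (n * (θ ^ 2 * δ / 2)) * (θ ^ 2 * η + |θ| ^ 3 * Real.exp (|θ| * B) * B * (δ + η) +
        (θ ^ 2 * δ / 2) ^ 2 + (|θ| * B + θ ^ 2 * B ^ 2 / 2) * (θ ^ 2 * δ / 2)) := by
  set A : ℝ := θ ^ 2 * δ / 2 with hA
  have hA0 : 0 ≤ A := by positivity
  set ρ : ℝ := θ ^ 2 * η + |θ| ^ 3 * Real.exp (|θ| * B) * B * (δ + η) + A ^ 2 + (|θ| * B + θ ^ 2 * B ^ 2 / 2) * A with hρ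
  have hρ0 : 0 ≤ ρ := by positivity
  -- the complex weights `W_k = exp(iθ S_k + (θ²/2) V_k)`
  set Wf : ℕ → Ω → ℂ := fun k ω => Complex.exp (((θ * ∑ j ∈ Finset.range k, D j ω : ℝ) : ℂ) * Complex.I +
    ((θ ^ 2 / 2 * ∑ j ∈ Finset.range k, v j ω : ℝ) : ℂ)) with hWf
  have hWF : ∀ k, Measurable[ℱ k] (Wf k) := fun k =>
    (((Complex.measurable_ofReal.comp ((hSF k).const_mul θ)).mul_const _).add
      (Complex.measurable_ofReal.comp ((hVF k).const_mul _))).cexp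
  have hWm : ∀ k, Measurable (Wf k) := fun k => (hWF k).mono (hℱ k) le_rfl
  have hVb : ∀ k ω, ∑ j ∈ Finset.range k, v j ω ≤ k * δ := fun k ω =>
    (Finset.sum_le_sum fun j _ => hvb j ω).trans (by rw [Finset.sum_const, Finset.card_range, nsmul_eq_mul])
  have hV0 : ∀ k ω, 0 ≤ ∑ j ∈ Finset.range k, v j ω := fun k ω => Finset.sum_nonneg fun j _ => hv0 j ω
  have hWn : ∀ k ω, ‖Wf k ω‖ = Real.exp (θ ^ 2 / 2 * ∑ j ∈ Finset.range k, v j ω) := fun k ω => by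
    simp only [hWf, Complex.norm_exp, Complex.add_re, Complex.mul_re, Complex.ofReal_re, Complex.I_re, Complex.ofReal_im,
      Complex.I_im, mul_zero, mul_one, sub_self, zero_add]
  have hWb : ∀ k ω, ‖Wf k ω‖ ≤ Real.exp (k * A) := fun k ω => by
    rw [hWn, Real.exp_le_exp, hA]
    have := hVb k ω
    nlinarith [sq_nonneg θ]
  -- the recursion `W_(k+1) = W_k · exp(iθ D_k + (θ²/2) v_k)`
  have hrec : ∀ k ω, Wf (k + 1) ω = Wf k ω * Complex.exp (((θ * D k ω : ℝ) : ℂ) * Complex.I + ((θ ^ 2 / 2 * v k ω : ℝ) : ℂ)) :=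
    fun k ω => by
      simp only [hWf]
      rw [← Complex.exp_add, Finset.sum_range_succ, Finset.sum_range_succ]
      push_cast
      ring_nf
  have hIntW : ∀ k, Integrable (Wf k) P := fun k =>
    (integrable_const (Real.exp (k * A))).mono' (hWm k).aestronglyMeasurable (Eventually.of_forall (hWb k))
  -- induction
  suffices h : ∀ m, m ≤ n → ‖(∫ ω, Wf m ω ∂P) - 1‖ ≤ m * Real.exp (m * A) * ρ by
    have := h n le_rfl
    simpa only [hWf] using this
  intro m
  induction m with
  | zero =>
    intro _
    have h0 : ∀ ω, Wf 0 ω = 1 := fun ω => by simp [hWf]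
    rw [integral_congr_ae (ae_of_all _ h0), integral_const, probReal_univ, one_smul, sub_self, norm_zero]
    simp
  | succ m ih =>
    intro hm
    have hmn : m < n := Nat.lt_of_succ_le hm
    have ih' := ih hmn.le
    have hstep := norm_integral_cweight_mul_cexp_sub_one_le (hℱ m) (hWF m) (Real.exp_pos _).le (hWb m) (hDm m) (hvm m)
      hB hδ hη (hDb m) (hv0 m) (hvb m) (horth m hmn) (hvar m hmn) θ
    have heq : (∫ ω, Wf (m + 1) ω ∂P) - 1 =
        (∫ ω, Wf m ω * (Complex.exp (((θ * D m ω : ℝ) : ℂ) * Complex.I + ((θ ^ 2 / 2 * v m ω : ℝ) : ℂ)) - 1) ∂P) +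
          ((∫ ω, Wf m ω ∂P) - 1) := by
      have h1 : ∀ ω, Wf (m + 1) ω = Wf m ω * (Complex.exp (((θ * D m ω : ℝ) : ℂ) * Complex.I +
          ((θ ^ 2 / 2 * v m ω : ℝ) : ℂ)) - 1) + Wf m ω := fun ω => by rw [hrec]; ring
      have i1 : Integrable (fun ω => Wf m ω * (Complex.exp (((θ * D m ω : ℝ) : ℂ) * Complex.I +
          ((θ ^ 2 / 2 * v m ω : ℝ) : ℂ)) - 1)) P := by
        have h2 : (fun ω => Wf m ω * (Complex.exp (((θ * D m ω : ℝ) : ℂ) * Complex.I +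
            ((θ ^ 2 / 2 * v m ω : ℝ) : ℂ)) - 1)) = fun ω => Wf (m + 1) ω - Wf m ω := funext fun ω => by rw [hrec]; ring
        rw [h2]; exact (hIntW (m + 1)).sub (hIntW m)
      rw [integral_congr_ae (ae_of_all _ h1), integral_add i1 (hIntW m)]
      ring
    rw [heq]
    calc ‖(∫ ω, Wf m ω * (Complex.exp (((θ * D m ω : ℝ) : ℂ) * Complex.I + ((θ ^ 2 / 2 * v m ω : ℝ) : ℂ)) - 1) ∂P) +
          ((∫ ω, Wf m ω ∂P) - 1)‖
        ≤ ‖∫ ω, Wf m ω * (Complex.exp (((θ * D m ω : ℝ) : ℂ) * Complex.I + ((θ ^ 2 / 2 * v m ω : ℝ) : ℂ)) - 1) ∂P‖ +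
          ‖(∫ ω, Wf m ω ∂P) - 1‖ := norm_add_le _ _
      _ ≤ Real.exp (m * A) * Real.exp (θ ^ 2 * δ / 2) * ρ + m * Real.exp (m * A) * ρ := add_le_add hstep ih'
      _ = (m + 1 : ℝ) * Real.exp ((m + 1 : ℝ) * A) * ρ + m * ρ * (Real.exp (m * A) - Real.exp ((m + 1 : ℝ) * A)) := by
          rw [show ((m + 1 : ℝ)) * A = m * A + θ ^ 2 * δ / 2 by rw [hA]; ring, Real.exp_add]
          ring
      _ ≤ (m + 1 : ℝ) * Real.exp ((m + 1 : ℝ) * A) * ρ + 0 := by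
          gcongr
          refine mul_nonpos_iff.2 (Or.inl ⟨by positivity, ?_⟩)
          have : Real.exp (m * A) ≤ Real.exp ((m + 1 : ℝ) * A) := Real.exp_le_exp.2 (by nlinarith)
          linarith
      _ = ((m + 1 : ℕ) : ℝ) * Real.exp (((m + 1 : ℕ) : ℝ) * A) * ρ := by push_cast; ring

end Summit.QuantumFields.YangMills.Theorems.ColdStartUniversality

end
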